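import Literature.Computability.Complexity.SumcheckMAReferee
import Literature.Computability.Complexity.CodeFPBudgets
import Literature.Computability.Complexity.CodeFPLists
import HarnessLib

/-!
# Dense integer polynomial arithmetic on coefficient lists, in polynomial time (`CodeFP`)

Toolkit for the honest sumcheck prover (`SumcheckHonestProver.lean`: the partial sums
`Sumcheck.h φ vl pref = ∑_b P_φ(pref, X, b)` of Arora–Barak's Thm. 8.21 are computed as explicit
integer polynomials in the distinguished variable). A polynomial is a coefficient list `List ℤ`
read by `SumcheckMA.ofCoeffs` (`c₀ + c₁ X + ⋯`, `coeff_ofCoeffs : coeff j = getD j 0`):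

* operations: `padd` (coefficientwise sum after padding, `CodeFP.zipWithPad`), `psum` (left fold of
  `padd`), `pscale`, `pshift` (multiplication by `C c`, by `X^i`), `pmul a b = psum (rows)` with the
  rows `X^i · aᵢ · b` (`List.mapIdx`), `pprod` (left fold of `pmul` from `[1]`);
* semantics: `ofCoeffs_padd`, `ofCoeffs_psum`, `ofCoeffs_pmul`, `ofCoeffs_pprod` (ring operations of
  `ℤ[X]`);
* size control through the `ℓ¹`-norm `l1 p = ∑ |pⱼ|` (subadditive, submultiplicative:
  `l1_padd_le`, `l1_psum_le`, `l1_pmul_le`, `l1_pprod_le`), lengths (`length_psum_le`,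
  `length_pmul_le`, `length_pprod_le`), and the code-length estimates `length_rawE_intE_le`,
  `size_l1_le_twice_length`;
* **`CodeFP` facts**: `paddC`, `psumC`, `pmulC`, `pprodC` (the two folds `psum`, `pprod` with their
  quadratic accumulator bounds discharged by the `ℓ¹` estimates).

## References

* D. E. Knuth, *The Art of Computer Programming*, Vol. 2, 3rd ed., 1998, §4.6.1 (arithmetic of
  polynomials: addition and multiplication of dense coefficient vectors). (Schoolbook; proved here.)
* S. Arora, B. Barak, *Computational Complexity: A Modern Approach*, CUP 2009, §1.3 (closure of
  polynomial time under composition and polynomially bounded loops).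
-/

noncomputable section

namespace Literature.Computability.Complexity

open _root_.Computability Polynomial Brick CodeFP Finset

namespace SumcheckMA

/-! ### The operations -/

/-- Coefficientwise sum, the shorter list padded with zeros. [cite: KnuthTAOCP2, §4.6.1] -/
def padd (a b : List ℤ) : List ℤ := zipWithPad (· + ·) 0 0 a b

/-- Sum of a list of polynomials (left fold of `padd` from `[]`). [cite: KnuthTAOCP2, §4.6.1] -/
def psum (L : List (List ℤ)) : List ℤ := L.foldl (fun acc p => padd acc p) []

/-- Multiplication by the constant `c`. [cite: KnuthTAOCP2, §4.6.1] -/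
def pscale (c : ℤ) (b : List ℤ) : List ℤ := b.map (c * ·)

/-- Multiplication by `X^i` (prepend `i` zeros). [cite: KnuthTAOCP2, §4.6.1] -/
def pshift (i : ℕ) (b : List ℤ) : List ℤ := List.replicate i 0 ++ b

/-- The rows of the schoolbook product: `X^i · aᵢ · b`. [cite: KnuthTAOCP2, §4.6.1] -/
def prows (a b : List ℤ) : List (List ℤ) := a.mapIdx fun i ai => pshift i (pscale ai b)

/-- **Product** of two polynomials: the sum of the rows. [cite: KnuthTAOCP2, §4.6.1] -/
def pmul (a b : List ℤ) : List ℤ := psum (prows a b)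

/-- Product of a list of polynomials (left fold of `pmul` from `[1]`). [cite: KnuthTAOCP2, §4.6.1] -/
def pprod (L : List (List ℤ)) : List ℤ := L.foldl (fun acc p => pmul acc p) [1]

/-! ### Semantics in `ℤ[X]` -/

/-- `ofCoeffs (a ⊕ b) = ofCoeffs a + ofCoeffs b`. [cite: KnuthTAOCP2, §4.6.1] -/
theorem ofCoeffs_padd (a b : List ℤ) : ofCoeffs (padd a b) = ofCoeffs a + ofCoeffs b := by
  ext j
  rw [coeff_add, coeff_ofCoeffs, coeff_ofCoeffs, coeff_ofCoeffs, padd]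
  by_cases hj : j < max a.length b.length
  · rw [getD_zipWithPad _ _ _ _ _ _ _ hj]
  · rw [List.getD_eq_default _ _ (by rw [length_zipWithPad]; omega), List.getD_eq_default _ _ (by omega),
      List.getD_eq_default _ _ (by omega), add_zero]

/-- The summing fold. [folklore] -/
theorem ofCoeffs_foldl_padd (L : List (List ℤ)) (acc : List ℤ) :
    ofCoeffs (L.foldl (fun acc p => padd acc p) acc) = ofCoeffs acc + (L.map ofCoeffs).sum := by
  induction L generalizing acc with
  | nil => simp
  | cons p L ih => rw [List.foldl_cons, ih, ofCoeffs_padd, List.map_cons, List.sum_cons, add_assoc]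

/-- `ofCoeffs (psum L) = ∑ ofCoeffs`. [cite: KnuthTAOCP2, §4.6.1] -/
theorem ofCoeffs_psum (L : List (List ℤ)) : ofCoeffs (psum L) = (L.map ofCoeffs).sum := by
  rw [psum, ofCoeffs_foldl_padd]
  simp [ofCoeffs]

/-- `ofCoeffs (c • b) = C c · ofCoeffs b`. [cite: KnuthTAOCP2, §4.6.1] -/
theorem ofCoeffs_pscale (c : ℤ) (b : List ℤ) : ofCoeffs (pscale c b) = C c * ofCoeffs b := by
  ext j
  rw [coeff_C_mul, coeff_ofCoeffs, coeff_ofCoeffs, pscale, List.getD_eq_getElem?_getD, List.getElem?_map,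
    List.getD_eq_getElem?_getD]
  cases b[j]? <;> simp

/-- `ofCoeffs (0ⁱ ++ b) = X^i · ofCoeffs b`. [cite: KnuthTAOCP2, §4.6.1] -/
theorem ofCoeffs_pshift (i : ℕ) (b : List ℤ) : ofCoeffs (pshift i b) = X ^ i * ofCoeffs b := by
  induction i with
  | zero => simp [pshift]
  | succ i ih =>
    rw [pshift, List.replicate_succ, List.cons_append, ofCoeffs, ← pshift, ih, pow_succ]
    simp only [map_zero, zero_add]
    ring

/-- The rows sum to the product (with an offset `i₀` in the exponents for the induction). [cite: KnuthTAOCP2, §4.6.1] -/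
theorem sum_prows_aux (b : List ℤ) : ∀ (a : List ℤ) (i₀ : ℕ),
    ((a.mapIdx fun i ai => pshift (i + i₀) (pscale ai b)).map ofCoeffs).sum = X ^ i₀ * (ofCoeffs a * ofCoeffs b)
  | [], i₀ => by simp [ofCoeffs]
  | c :: a, i₀ => by
    rw [List.mapIdx_cons, List.map_cons, List.sum_cons, zero_add, ofCoeffs_pshift, ofCoeffs_pscale, ofCoeffs]
    have hfun : (fun (i : ℕ) (ai : ℤ) => pshift (i + 1 + i₀) (pscale ai b)) = fun i ai => pshift (i + (i₀ + 1)) (pscale ai b) := by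
      funext i ai; rw [add_assoc, add_comm 1]
    rw [hfun, sum_prows_aux b a (i₀ + 1), pow_succ]
    ring

/-- **`ofCoeffs (a ⊗ b) = ofCoeffs a · ofCoeffs b`.** [cite: KnuthTAOCP2, §4.6.1] -/
theorem ofCoeffs_pmul (a b : List ℤ) : ofCoeffs (pmul a b) = ofCoeffs a * ofCoeffs b := by
  rw [pmul, ofCoeffs_psum, prows]
  have := sum_prows_aux b a 0
  simp only [add_zero, pow_zero, one_mul] at this
  exact this

/-- The multiplying fold. [folklore] -/
theorem ofCoeffs_foldl_pmul (L : List (List ℤ)) (acc : List ℤ) :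
    ofCoeffs (L.foldl (fun acc p => pmul acc p) acc) = ofCoeffs acc * (L.map ofCoeffs).prod := by
  induction L generalizing acc with
  | nil => simp
  | cons p L ih => rw [List.foldl_cons, ih, ofCoeffs_pmul, List.map_cons, List.prod_cons, mul_assoc]

/-- **`ofCoeffs (pprod L) = ∏ ofCoeffs`.** [cite: KnuthTAOCP2, §4.6.1] -/
theorem ofCoeffs_pprod (L : List (List ℤ)) : ofCoeffs (pprod L) = (L.map ofCoeffs).prod := by
  rw [pprod, ofCoeffs_foldl_pmul]
  simp [ofCoeffs]

/-- `ofCoeffs [c] = C c`. [folklore] -/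
@[simp] theorem ofCoeffs_singleton (c : ℤ) : ofCoeffs [c] = C c := by simp [ofCoeffs]

/-- `ofCoeffs [0, 1] = X`. [folklore] -/
@[simp] theorem ofCoeffs_X : ofCoeffs [0, 1] = X := by simp [ofCoeffs]

/-! ### Lengths -/

/-- Length of a sum of two. [folklore] -/
@[simp] theorem length_padd (a b : List ℤ) : (padd a b).length = max a.length b.length :=
  length_zipWithPad _ _ _ _ _

/-- Length of a sum: at most the sum of the lengths (crude). [folklore] -/
theorem length_foldl_padd_le (L : List (List ℤ)) (acc : List ℤ) :
    (L.foldl (fun acc p => padd acc p) acc).length ≤ acc.length + (L.map List.length).sum := by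
  induction L generalizing acc with
  | nil => simp
  | cons p L ih =>
    rw [List.foldl_cons, List.map_cons, List.sum_cons]
    refine (ih _).trans ?_
    rw [length_padd]
    omega

/-- Length of `psum`. [folklore] -/
theorem length_psum_le (L : List (List ℤ)) : (psum L).length ≤ (L.map List.length).sum := by
  unfold psum
  simpa using length_foldl_padd_le L []

/-- Length of a sum is at least every summand's. [folklore] -/
theorem length_le_length_foldl_padd (L : List (List ℤ)) (acc : List ℤ) :
    acc.length ≤ (L.foldl (fun acc p => padd acc p) acc).length ∧
      ∀ p ∈ L, p.length ≤ (L.foldl (fun acc p => padd acc p) acc).length := by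
  induction L generalizing acc with
  | nil => simp
  | cons q L ih =>
    rw [List.foldl_cons]
    have h := ih (padd acc q)
    rw [length_padd] at h
    refine ⟨le_trans (le_max_left _ _) h.1, fun p hp => ?_⟩
    rcases List.mem_cons.1 hp with rfl | hp
    · exact le_trans (le_max_right _ _) h.1
    · exact h.2 p hp

/-- Length of a row. [folklore] -/
@[simp] theorem length_pshift_pscale (i : ℕ) (c : ℤ) (b : List ℤ) : (pshift i (pscale c b)).length = i + b.length := by
  simp [pshift, pscale]

/-- Length of a product of two. [folklore] -/
theorem length_pmul_le (a b : List ℤ) : (pmul a b).length ≤ a.length + b.length := by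
  rw [pmul, psum]
  rcases Nat.eq_zero_or_pos a.length with ha | ha
  · rw [List.length_eq_zero_iff.1 ha]; simp [prows]
  · have hrows : ∀ r ∈ prows a b, r.length ≤ a.length + b.length := fun r hr => by
      rw [prows] at hr
      obtain ⟨i, hi, rfl⟩ : ∃ i, ∃ (h : i < a.length), r = pshift i (pscale (a[i]) b) := by
        rw [List.mem_iff_getElem] at hr
        obtain ⟨i, hi, rfl⟩ := hr
        refine ⟨i, by simpa using hi, ?_⟩
        rw [List.getElem_mapIdx]
      simp; omega
    -- the fold never exceeds the maximum row length
    have key : ∀ (L : List (List ℤ)) (acc : List ℤ), acc.length ≤ a.length + b.length →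
        (∀ r ∈ L, r.length ≤ a.length + b.length) → (L.foldl (fun acc p => padd acc p) acc).length ≤ a.length + b.length := by
      intro L
      induction L with
      | nil => intro acc h _; simpa using h
      | cons r L ih =>
        intro acc h hL
        rw [List.foldl_cons]
        exact ih _ (by rw [length_padd]; exact max_le h (hL r (by simp))) fun r' hr' => hL r' (by simp [hr'])
    exact key _ [] (by simp) hrows

/-- Length of a product. [folklore] -/
theorem length_foldl_pmul_le (L : List (List ℤ)) (acc : List ℤ) :
    (L.foldl (fun acc p => pmul acc p) acc).length ≤ acc.length + (L.map List.length).sum := by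
  induction L generalizing acc with
  | nil => simp
  | cons p L ih =>
    rw [List.foldl_cons, List.map_cons, List.sum_cons]
    refine (ih _).trans ?_
    have := length_pmul_le acc p
    omega

/-- Length of `pprod`. [folklore] -/
theorem length_pprod_le (L : List (List ℤ)) : (pprod L).length ≤ 1 + (L.map List.length).sum := by
  unfold pprod
  simpa using length_foldl_pmul_le L [1]

/-! ### The `ℓ¹` norm -/

/-- `ℓ¹`-norm of a coefficient list: `∑ |pⱼ|`. [folklore] -/
def l1 (p : List ℤ) : ℕ := (p.map Int.natAbs).sum

/-- `l1 [] = 0`. [folklore] -/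
@[simp] theorem l1_nil : l1 [] = 0 := rfl

/-- `l1` of a cons. [folklore] -/
@[simp] theorem l1_cons (c : ℤ) (p : List ℤ) : l1 (c :: p) = c.natAbs + l1 p := by simp [l1]

/-- `l1` of an append. [folklore] -/
@[simp] theorem l1_append (p q : List ℤ) : l1 (p ++ q) = l1 p + l1 q := by simp [l1]

/-- `l1` as a sum over a range of indices covering the list. [folklore] -/
theorem l1_eq_sum_range (p : List ℤ) {N : ℕ} (hN : p.length ≤ N) : l1 p = ∑ j ∈ range N, (p.getD j 0).natAbs := by
  induction p generalizing N with
  | nil => simp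
  | cons c p ih =>
    cases N with
    | zero => simp at hN
    | succ N =>
      rw [l1_cons, sum_range_succ', ih (by simpa using hN)]
      simp [add_comm]

/-- Every coefficient is bounded by the `ℓ¹`-norm. [folklore] -/
theorem natAbs_getD_le_l1 (p : List ℤ) (j : ℕ) : (p.getD j 0).natAbs ≤ l1 p := by
  by_cases hj : j < p.length
  · rw [l1_eq_sum_range p le_rfl]
    exact single_le_sum (f := fun j => (p.getD j 0).natAbs) (fun _ _ => Nat.zero_le _) (mem_range.2 hj)
  · rw [List.getD_eq_default _ _ (Nat.le_of_not_lt hj)]; simp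

/-- Every coefficient is bounded by the `ℓ¹`-norm (membership form). [folklore] -/
theorem natAbs_le_l1_of_mem {p : List ℤ} {c : ℤ} (h : c ∈ p) : c.natAbs ≤ l1 p := by
  unfold l1
  exact List.single_le_sum (fun _ _ => Nat.zero_le _) _ (List.mem_map_of_mem h)

/-- `ℓ¹` is subadditive. [folklore] -/
theorem l1_padd_le (a b : List ℤ) : l1 (padd a b) ≤ l1 a + l1 b := by
  rw [l1_eq_sum_range (padd a b) (N := max a.length b.length) (by simp), l1_eq_sum_range a (le_max_left _ _),
    l1_eq_sum_range b (le_max_right _ _), ← sum_add_distrib]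
  refine sum_le_sum fun j hj => ?_
  rw [padd, getD_zipWithPad _ _ _ _ _ _ _ (mem_range.1 hj)]
  exact Int.natAbs_add_le _ _

/-- `ℓ¹` of a fold of sums. [folklore] -/
theorem l1_foldl_padd_le (L : List (List ℤ)) (acc : List ℤ) :
    l1 (L.foldl (fun acc p => padd acc p) acc) ≤ l1 acc + (L.map l1).sum := by
  induction L generalizing acc with
  | nil => simp
  | cons p L ih =>
    rw [List.foldl_cons, List.map_cons, List.sum_cons]
    refine (ih _).trans ?_
    have := l1_padd_le acc p
    omega

/-- `ℓ¹` of `psum`. [folklore] -/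
theorem l1_psum_le (L : List (List ℤ)) : l1 (psum L) ≤ (L.map l1).sum := by
  unfold psum
  simpa using l1_foldl_padd_le L []

/-- `ℓ¹` of a scaling. [folklore] -/
theorem l1_pscale (c : ℤ) (b : List ℤ) : l1 (pscale c b) = c.natAbs * l1 b := by
  induction b with
  | nil => simp [pscale, l1]
  | cons x b ih =>
    simp only [pscale, List.map_cons, l1_cons, Int.natAbs_mul] at ih ⊢
    rw [ih]; ring

/-- `ℓ¹` of a shift. [folklore] -/
@[simp] theorem l1_pshift (i : ℕ) (b : List ℤ) : l1 (pshift i b) = l1 b := by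
  rw [pshift, l1_append]
  simp [l1]

/-- A `mapIdx` whose function ignores the index is a `map`. [folklore] -/
theorem mapIdx_const {α β : Type} (f : α → β) (l : List α) : l.mapIdx (fun _ a => f a) = l.map f := by
  apply List.ext_getElem (by simp)
  intro i h1 h2
  rw [List.getElem_mapIdx, List.getElem_map]

/-- The `ℓ¹`-norms of the rows. [folklore] -/
theorem map_l1_prows (a b : List ℤ) : (prows a b).map l1 = a.map fun ai => ai.natAbs * l1 b := by
  apply List.ext_getElem (by simp [prows])
  intro i h1 h2
  rw [List.getElem_map, List.getElem_map]
  unfold prows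
  rw [List.getElem_mapIdx, l1_pshift, l1_pscale]

/-- **`ℓ¹` is submultiplicative.** [folklore] -/
theorem l1_pmul_le (a b : List ℤ) : l1 (pmul a b) ≤ l1 a * l1 b := by
  rw [pmul]
  refine (l1_psum_le _).trans (le_of_eq ?_)
  rw [map_l1_prows, List.sum_map_mul_right]
  rfl

/-- `ℓ¹` of a fold of products. [folklore] -/
theorem l1_foldl_pmul_le (L : List (List ℤ)) (acc : List ℤ) :
    l1 (L.foldl (fun acc p => pmul acc p) acc) ≤ l1 acc * (L.map l1).prod := by
  induction L generalizing acc with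
  | nil => simp
  | cons p L ih =>
    rw [List.foldl_cons, List.map_cons, List.prod_cons, ← mul_assoc]
    exact (ih _).trans (Nat.mul_le_mul_right _ (l1_pmul_le acc p))

/-- **`ℓ¹` of `pprod`**: at most the product of the norms. [folklore] -/
theorem l1_pprod_le (L : List (List ℤ)) : l1 (pprod L) ≤ (L.map l1).prod := by
  unfold pprod
  simpa [l1] using l1_foldl_pmul_le L [1]

/-! ### Code lengths -/

/-- The code of a coefficient list: `≤ |p| · (6 size ‖p‖₁ + 6)`. [folklore] -/
theorem length_rawE_intE_le (p : List ℤ) : (rawE intE p).length ≤ p.length * (6 * Nat.size (l1 p) + 6) := by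
  rw [length_rawE]
  have : ∀ x ∈ p.map (fun c => 2 * (intE c).length + 2), x ≤ 6 * Nat.size (l1 p) + 6 := fun x hx => by
    obtain ⟨c, hc, rfl⟩ := List.mem_map.1 hx
    have h1 := length_dpEnc_le c
    have h2 : Nat.size c.natAbs ≤ Nat.size (l1 p) := size_mono (natAbs_le_l1_of_mem hc)
    change 2 * (dpEnc c).length + 2 ≤ _
    omega
  refine (List.sum_le_card_nsmul _ _ this).trans ?_
  simp

/-- The norm is small next to the code: `size ‖p‖₁ ≤ 2 |code p|`. [folklore] -/
theorem size_l1_le_twice_length (p : List ℤ) : Nat.size (l1 p) ≤ 2 * (rawE intE p).length := by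
  have h := size_sum_le (l := p.map Int.natAbs) (M := (rawE intE p).length) fun x hx => by
    obtain ⟨c, hc, rfl⟩ := List.mem_map.1 hx
    refine (size_natAbs_le_length_intE c).trans ?_
    have := length_item_le_length_rawE intE hc
    omega
  have h2 := length_le_length_rawE intE p
  rw [List.length_map] at h
  unfold l1
  omega

/-- The items of a coded list of polynomials fit in the code. [folklore] -/
theorem sum_length_rawE_le (L : List (List ℤ)) : (L.map fun p => (rawE intE p).length).sum ≤ (rawE (rawE intE) L).length := by
  rw [length_rawE (rawE intE) L]
  exact List.sum_le_sum fun p _ => by omega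

/-- Total length of the polynomials of a coded list. [folklore] -/
theorem sum_length_le (L : List (List ℤ)) : (L.map List.length).sum ≤ (rawE (rawE intE) L).length :=
  (List.sum_le_sum fun p _ => length_le_length_rawE intE p).trans (sum_length_rawE_le L)

/-- Total size of the norms of a coded list. [folklore] -/
theorem sum_size_l1_le (L : List (List ℤ)) : (L.map fun p => Nat.size (l1 p)).sum ≤ 2 * (rawE (rawE intE) L).length := by
  refine (List.sum_le_sum fun p _ => size_l1_le_twice_length p).trans ?_
  have h := sum_length_rawE_le L
  have : (L.map fun p => 2 * (rawE intE p).length).sum = 2 * (L.map fun p => (rawE intE p).length).sum := by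
    rw [List.sum_map_mul_left]
  omega

/-! ### `CodeFP` facts -/

/-- **Coefficientwise sum** on codes. [cite: AroraBarakCC2009, §1.3] -/
theorem paddC : CodeFP (pairE (rawE intE) (rawE intE)) (rawE intE) (fun p => padd p.1 p.2) := by
  have hg : CodeFP (pairE unitE (pairE intE intE)) intE (fun t => t.2.1 + t.2.2) := (intAdd.comp (snd _ _) :)
  have hz := zipWithPadCtx (σ := Unit) (eσ := unitE) (g := fun t : Unit × ℤ × ℤ => t.2.1 + t.2.2)
    (dα := fun _ => (0 : ℤ)) (dβ := fun _ => (0 : ℤ)) hg (const _ 0) (const _ 0)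
  exact (hz.comp ((const _ ()).pair (CodeFP.id _))).congr fun _ => rfl

/-- **Sums of coded lists of polynomials** (`psum`, a fold with accumulator bound `18 L² + 6 L`). [cite: AroraBarakCC2009, §1.3] -/
theorem psumC : CodeFP (rawE (rawE intE)) (rawE intE) psum := by
  have hstep : CodeFP (pairE (rawE intE) (rawE intE)) (rawE intE) (fun t => padd t.2 t.1) :=
    (paddC.comp ((snd _ _).pair (fst _ _)) :)
  have h := foldl₀ (step := fun (p : List ℤ) acc => padd acc p) (b₀ := []) hstep (18 * X ^ 2 + 6 * X) (fun l₁ l₂ => by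
    set Lc := (rawE (rawE intE) (l₁ ++ l₂)).length with hLc
    set r := l₁.foldl (fun b a => padd b a) [] with hr
    have hLc₁ : (rawE (rawE intE) l₁).length ≤ Lc :=
      length_rawE_le_of_sublist (rawE intE) (List.sublist_append_left l₁ l₂)
    have hlen : r.length ≤ Lc := by
      have := length_foldl_padd_le l₁ []
      rw [List.length_nil, zero_add] at this
      exact this.trans ((sum_length_le l₁).trans hLc₁)
    have hl1 : Nat.size (l1 r) ≤ 3 * Lc := by
      have h1 : l1 r ≤ (l₁.map l1).sum := by simpa using l1_foldl_padd_le l₁ []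
      refine (size_mono h1).trans ((size_sum_le (M := 2 * Lc) fun x hx => ?_).trans ?_)
      · obtain ⟨p, hp, rfl⟩ := List.mem_map.1 hx
        exact (size_l1_le_twice_length p).trans (Nat.mul_le_mul_left 2
          ((le_trans (by omega) (length_item_le_length_rawE (rawE intE) hp)).trans hLc₁))
      · have : l₁.length ≤ Lc := (length_le_length_rawE (rawE intE) l₁).trans hLc₁
        rw [List.length_map]; omega
    simp only [eval_add, eval_mul, eval_pow, eval_X, eval_ofNat]
    refine (length_rawE_intE_le r).trans ?_
    calc r.length * (6 * Nat.size (l1 r) + 6) ≤ Lc * (6 * (3 * Lc) + 6) :=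
          Nat.mul_le_mul hlen (by omega)
      _ = 18 * Lc ^ 2 + 6 * Lc := by ring)
  exact h.congr fun l => rfl

/-- **Scaling** on codes. [cite: AroraBarakCC2009, §1.3] -/
theorem pscaleC : CodeFP (pairE intE (rawE intE)) (rawE intE) (fun p => pscale p.1 p.2) :=
  (map (σ := ℤ) (eσ := intE) (g := fun t : ℤ × ℤ => t.1 * t.2) intMul).congr fun _ => rfl

/-- **The rows of the product** on codes (`mapIdx`; the shift `0ⁱ` by `replicateOf` with the unary
budget `|a| ≥ i`). [cite: AroraBarakCC2009, §1.3] -/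
theorem prowsC : CodeFP (pairE (rawE intE) (rawE intE)) (rawE (rawE intE)) (fun p => prows p.1 p.2) := by
  -- context `(b, 1^{|a|})`, item `(i, aᵢ)`
  have hb : CodeFP (pairE (pairE (rawE intE) unE) (pairE natE intE)) (rawE intE) (fun t => t.1.1) := (fst _ _).fst'
  have hcap : CodeFP (pairE (pairE (rawE intE) unE) (pairE natE intE)) unE (fun t => t.1.2) := (fst _ _).snd'
  have hi : CodeFP (pairE (pairE (rawE intE) unE) (pairE natE intE)) natE (fun t => t.2.1) := (snd _ _).fst'
  have hai : CodeFP (pairE (pairE (rawE intE) unE) (pairE natE intE)) intE (fun t => t.2.2) := (snd _ _).snd'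
  have hrow : CodeFP (pairE (pairE (rawE intE) unE) (pairE natE intE)) (rawE intE)
      (fun t => List.replicate (min t.2.1 t.1.2) 0 ++ pscale t.2.2 t.1.1) :=
    ((rawAppend intE).comp (((replicateOf intE).comp ((const _ (0 : ℤ)).pair (unOfNatMin.comp (hcap.pair hi)))).pair
      (pscaleC.comp (hai.pair hb))) :)
  have hm := mapIdx (σ := List ℤ × ℕ) (eσ := pairE (rawE intE) unE)
    (g := fun t : (List ℤ × ℕ) × ℕ × ℤ => List.replicate (min t.2.1 t.1.2) 0 ++ pscale t.2.2 t.1.1) hrow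
  have hall : CodeFP (pairE (rawE intE) (rawE intE)) (rawE (rawE intE))
      (fun p => p.1.mapIdx fun i ai => List.replicate (min i p.1.length) 0 ++ pscale ai p.2) :=
    (hm.comp (((snd _ _).pair ((ulength intE).comp (fst _ _))).pair (fst _ _)) :)
  refine hall.congr fun p => ?_
  unfold prows pshift
  apply List.ext_getElem (by simp)
  intro i h1 h2
  rw [List.getElem_mapIdx, List.getElem_mapIdx, min_eq_left]
  rw [List.length_mapIdx] at h1
  exact h1.le

/-- **Products of two polynomials** on codes. [cite: AroraBarakCC2009, §1.3] -/
theorem pmulC : CodeFP (pairE (rawE intE) (rawE intE)) (rawE intE) (fun p => pmul p.1 p.2) :=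
  (psumC.comp prowsC).congr fun _ => rfl

/-- **Products of coded lists of polynomials** (`pprod`, a fold with accumulator bound `12 (L+1)²`).
[cite: AroraBarakCC2009, §1.3] -/
theorem pprodC : CodeFP (rawE (rawE intE)) (rawE intE) pprod := by
  have hstep : CodeFP (pairE (rawE intE) (rawE intE)) (rawE intE) (fun t => pmul t.2 t.1) :=
    (pmulC.comp ((snd _ _).pair (fst _ _)) :)
  have h := foldl₀ (step := fun (p : List ℤ) acc => pmul acc p) (b₀ := [1]) hstep (12 * (X + 1) ^ 2) (fun l₁ l₂ => by
    set Lc := (rawE (rawE intE) (l₁ ++ l₂)).length with hLc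
    set r := l₁.foldl (fun b a => pmul b a) [1] with hr
    have hLc₁ : (rawE (rawE intE) l₁).length ≤ Lc :=
      length_rawE_le_of_sublist (rawE intE) (List.sublist_append_left l₁ l₂)
    have hlen : r.length ≤ 1 + Lc := by
      have := length_foldl_pmul_le l₁ [1]
      simp only [List.length_singleton] at this
      exact this.trans (Nat.add_le_add_left ((sum_length_le l₁).trans hLc₁) 1)
    have hl1 : Nat.size (l1 r) ≤ 2 * Lc + 1 := by
      have h1 : l1 r ≤ (l₁.map l1).prod := by simpa [l1] using l1_foldl_pmul_le l₁ [1]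
      refine (size_mono h1).trans ((size_prod_le _).trans ?_)
      rw [List.map_map]
      have : (l₁.map (Nat.size ∘ l1)).sum ≤ 2 * Lc :=
        (sum_size_l1_le l₁).trans (Nat.mul_le_mul_left 2 hLc₁)
      omega
    simp only [eval_add, eval_mul, eval_pow, eval_X, eval_ofNat, eval_one]
    refine (length_rawE_intE_le r).trans ?_
    calc r.length * (6 * Nat.size (l1 r) + 6) ≤ (1 + Lc) * (6 * (2 * Lc + 1) + 6) :=
          Nat.mul_le_mul hlen (by omega)
      _ = 12 * (Lc + 1) ^ 2 := by ring)
  exact h.congr fun l => rfl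

end SumcheckMA

end Literature.Computability.Complexity

end
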